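import Literature.AnabelianGeometry.EtaleTheta.Discharge.Sec2Cor219iiiPullback
import Literature.AnabelianGeometry.EtaleTheta.RigidOfSetting
import Literature.AnabelianGeometry.EtaleTheta.Discharge.Sec2GalExtensionCocycles
import HarnessLib

/-!
# [EtTh] Cor. 2.19 (iii), tower form — the HEART lemma M1 of row «COR219III-AT-MODELTATE», GENERIC preliminaries:
# on `Π^tp_Ÿ̲̲ ∩ θ⁻¹(Δ_Θ)` the transport `Φ_γ f`, the root cocycle `f` and all its conjugates are TAUTOLOGICAL (`= θ`),
# and on `Δ_P = Π^tp_Ÿ̲̲ ∩ Ker(aug)` they are HOMOMORPHISMS (proof-only)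

S. Mochizuki, *The étale theta function and its Frobenioid-theoretic manifestations*, Publ. RIMS **45** (2009) [EtTh],
§2, Cor. 2.19 (iii), PRIMS PDF p. 65; Cor. 2.19 (i) p. 64 («the étale theta class determines an isomorphism between
`Δ_Θ` and the coefficients» — cocycle form `rootCocycle_apply`); Prop. 1.1 / p. 12 («`Δ^Θ_X` is a central extension»)
[cite: MochizukiEtTh2009, Cor 2.19(iii) p.65].

Cell `abc-iut`, seat abc-iut-f-142 (gen 5), K-L6 row «COR219III-M1» (abc-iut-L6-lead §F 22:28:32Z GO; roadmap of record
HOME/staging/L6/w4-d038/g9/COR219III-PART2-ROADMAP.md v3 §1 «M-lemmas»).  PROOF-ONLY (no definition, no instance, no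
notation, no new named fact); GENERIC over every §1 setting `D`, every `E`, every `X̲̲`-choice `C`, every tower `τ`;
abc-iut-w4-d038's toolkit (`exists_lDeltaAut`, `exists_transport`, `apply_mem_PiYdd`), abc-iut-L2-t8's `conjRoot` /
`rootCocycles`, abc-iut-L2-d1's `rootCocycle_apply` consumed BY NAME, nothing restated.

WHAT IS SHOWN.  The roadmap's route for M1 («both sides are continuous homs `Δ_{Y̲̲} → μ_M`, tautological on
`K' := θ⁻¹(Λ)`, so determined by one value») made kernel facts at the generic level:
* §1 `conjRoot_coe_eq_toTheta_of_mem` (R2) — for a root cocycle `f` and ANY `σ ∈ Π^tp_X̲̲`, `conjRoot σ f k = θ(k)` whenever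
  `θ(k) ∈ Δ_Θ`; `transport_coe_eq_toTheta_of_mem` (R1) — the transport `F = Φ_γ f` of `exists_transport` (clause (a)) is
  tautological there too: `F k = θ(k)` (the defining property of `γ̃`, `rootCocycle_apply` at `γ k`, `comap_DeltaTheta_Huu`).
  Hence `F` and every `conjRoot (ã^m) f` AGREE on `Π^tp_Ÿ̲̲ ∩ θ⁻¹(Δ_Θ)` exactly (not only mod `M`).
* §2 (R3) — on `Δ_P := Π^tp_Ÿ̲̲ ∩ Ker(aug)` every `Δ_Θ`-valued cocycle for the conjugation action is MULTIPLICATIVE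
  (`θ(Ker aug)` centralises `Δ_Θ`: the setting's `ker_thetaToEll_central`, abc-iut's landed `conjNormal_eq_of_aug_eq_one`
  consumed BY NAME): `apply_mul_of_aug_eq_one` (any continuous cocycle),
  `conjRoot_mul_of_aug_eq_one` (its conjugates), `transport_mul_of_aug_eq_one` (the transport, from clause (b) of
  `exists_transport`).
* §3 (A) `MonoidHom.eq_of_eqOn_of_dense_closure` — two continuous homomorphisms into a Hausdorff group that agree on a set
  whose generated subgroup is dense agree everywhere (the uniqueness principle the value computation at ONE topological
  generator feeds).
v2 (append-only, §4 = V1): `conjRoot_coe_eq_toTheta_comm_mul` — at geometric elements `conjRoot σ f k = θ[σ⁻¹,k] · f k`.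
v3 (append-only, §5): `ThetaSetting.toTheta_conj_zpow_comm` — bilinearity `θ[σ^{-m}, k] = θ[σ⁻¹, k]^m` for geometric σ, k.
v4 (append-only, §6): `heart_of_uniqueness_of_onto` — M1 ASSEMBLED over any setting from (D1*) uniqueness on `Δ_P`, (D1′) onto,
and local constancy of the two sides.
WHAT IS LEFT FOR M1 AT THE MODEL (`modelχq p 1 2`, next seat; exact signature in the seat's work file
`HOME/staging/f/f-142/gen5/COR219III/M1Statement.lean`, farm-elaborated): (D1) `Δ_P / (Δ_P ∩ θ⁻¹(Δ_Θ))` is topologically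
generated by one element `b`; (V) the two values `red_M (F b)` and `red_M (conjRoot (ã^m) f b)` as powers of `ζ_M` (ŷ-coordinate,
`[b, ã]`).  HONEST FRAMING: unconditional statements about OUR typed objects over an arbitrary §1 setting; nothing of [EtTh]
(refereed) asserted beyond what is proved; no side taken on [IUTchIII] Cor. 3.12; typed ≠ proved; no abc claim.
-/

noncomputable section

namespace Literature.AnabelianGeometry.EtaleTheta

open Literature.AnabelianGeometry.SemiGraphs

namespace ThetaSetting.EtaleThetaData.DoubleUnderline

variable {p : ℕ} [Fact p.Prime] {D : ThetaSetting p} {E : D.EtaleThetaData} {l : ℕ}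
  (C : E.DoubleUnderline l) {Es : Set ℕ+} (τ : D.CyclotomeTower l Es)

/-! ## §1. Tautological values on `Π^tp_Ÿ̲̲ ∩ θ⁻¹(Δ_Θ)` (R1, R2) -/

/-- `θ(σ⁻¹ k σ) ∈ Δ_Θ` when `θ(k) ∈ Δ_Θ` (`Δ_Θ = Ker((Π^tp_X)^Θ ↠ (Π^tp_X)^ell)` is normal).
[cite: MochizukiEtTh2009, Prop 1.1 p.12] -/
theorem toTheta_conj_mem_DeltaTheta (σ : D.PiTemp) {k : D.PiTemp} (hk : D.toTheta k ∈ D.DeltaTheta) :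
    D.toTheta (σ⁻¹ * k * σ) ∈ D.DeltaTheta := by
  rw [map_mul, map_mul, map_inv]
  change _ ∈ D.thetaToEll.ker
  have hk' : D.toTheta k ∈ D.thetaToEll.ker := hk
  rw [MonoidHom.mem_ker] at hk' ⊢
  rw [map_mul, map_mul, map_inv, hk', mul_one, inv_mul_cancel]

/-- **(R2) Conjugates of a root cocycle are tautological on `θ⁻¹(Δ_Θ)`**: for `f ∈ rootCocycles`, EVERY `σ ∈ Π^tp_X̲̲` and
`k ∈ Π^tp_Ÿ̲̲` with `θ(k) ∈ Δ_Θ`, `conjRoot σ f k = θ(k)` (as elements of `(Π^tp_X)^Θ`): `f(σ⁻¹kσ) = θ(σ⁻¹kσ)`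
(`rootCocycle_apply`, Prop. 1.5 (iii)) and `θσ · θ(σ⁻¹kσ) · θσ⁻¹ = θk`. [cite: MochizukiEtTh2009, Cor 2.19 (i) p.64] -/
theorem conjRoot_coe_eq_toTheta_of_mem (hC : D.Compat) (h15 : Prop15iii E hC)
    {f : contCocycles D.toTheta D.DeltaTheta C.GtpYdduu} (hf : f ∈ C.rootCocycles hC) (σ : C.Huu)
    (k : C.GtpYdduu) (hk : D.toTheta (k : D.PiTemp) ∈ D.DeltaTheta) :
    (C.conjRoot hC σ f.1 k : D.GtpTheta) = D.toTheta (k : D.PiTemp) := by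
  have hk' : D.toTheta (((⟨_, C.conj_mem_GtpYdduu hC σ k⟩ : C.GtpYdduu) : D.PiTemp)) ∈ D.DeltaTheta :=
    toTheta_conj_mem_DeltaTheta (σ : D.PiTemp) hk
  change ((MulAut.conjNormal (D.toTheta (σ : D.PiTemp)) (f.1 ⟨_, C.conj_mem_GtpYdduu hC σ k⟩) : D.DeltaTheta) :
    D.GtpTheta) = _
  rw [MulAut.conjNormal_apply, C.rootCocycle_apply hC h15 hf _ hk']
  change D.toTheta (σ : D.PiTemp) * D.toTheta ((σ : D.PiTemp)⁻¹ * k * σ) * (D.toTheta (σ : D.PiTemp))⁻¹ = _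
  rw [map_mul, map_mul, map_inv]
  group

/-- Membership bookkeeping: `k ∈ Π^tp_Ÿ̲̲` with `θ(k) ∈ Δ_Θ` lies in the tower's `θ⁻¹(l·Δ_Θ)` (inside `Π^tp_X̲̲` the inverse
images of `Δ_Θ` and of `l·Δ_Θ` coincide, `comap_DeltaTheta_Huu`). [cite: MochizukiEtTh2009, Prop 2.12 (i) p.45] -/
theorem mem_lDeltaTheta_tower_of_toTheta_mem (hC : D.Compat) (hS : D.Sec2Hyps)
    (g : (C.thetaEnvTower τ hC hS).PiYdd) (hk : D.toTheta ((g : C.Huu) : D.PiTemp) ∈ D.DeltaTheta) :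
    (g : (C.thetaEnvTower τ hC hS).PiX) ∈ (C.thetaEnvTower τ hC hS).lDeltaTheta := by
  change (g : C.Huu) ∈ (D.lDeltaTheta l).comap (D.toTheta.comp C.Huu.subtype)
  rw [← C.comap_DeltaTheta_Huu, Subgroup.mem_comap]
  exact hk

/-- **(R1) The transport is tautological on `θ⁻¹(Δ_Θ)`**: with `γ` stabilising `Π^tp_Ÿ̲̲` and `θ⁻¹(l·Δ_Θ)`, `γ̃` induced by
`γ` (`exists_lDeltaAut`) and `F = Φ_γ f` given by clause (a) of `exists_transport` for a root cocycle `f`: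
`F k = θ(k)` for every `k ∈ Π^tp_Ÿ̲̲` with `θ(k) ∈ Δ_Θ` — `f(γk) = θ(γk) = γ̃(θk)`, so `γ̃⁻¹` returns `θk`.
[cite: MochizukiEtTh2009, Cor 2.19(iii) p.65] -/
theorem transport_coe_eq_toTheta_of_mem (hC : D.Compat) (hS : D.Sec2Hyps) (h15 : Prop15iii E hC)
    (γ : (C.thetaEnvTower τ hC hS).PiX ≃ₜ* (C.thetaEnvTower τ hC hS).PiX)
    (hγ : (C.thetaEnvTower τ hC hS).PiYdd.map γ.toMulEquiv.toMonoidHom = (C.thetaEnvTower τ hC hS).PiYdd)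
    (hL : (C.thetaEnvTower τ hC hS).lDeltaTheta.map γ.toMulEquiv.toMonoidHom = (C.thetaEnvTower τ hC hS).lDeltaTheta)
    (γΛ : D.lDeltaTheta l ≃* D.lDeltaTheta l)
    (hγΛ : ∀ (g : (C.thetaEnvTower τ hC hS).lDeltaTheta) (hg : γ g ∈ (C.thetaEnvTower τ hC hS).lDeltaTheta),
      C.toLDelta ⟨γ g, hg⟩ = γΛ (C.toLDelta g))
    {f : contCocycles D.toTheta D.DeltaTheta C.GtpYdduu} (hf : f ∈ C.rootCocycles hC)
    (F : C.GtpYdduu → D.lDeltaTheta l)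
    (hF : ∀ g : (C.thetaEnvTower τ hC hS).PiYdd,
      F (C.inclYdduu g) = γΛ.symm ⟨(f.1 (C.inclYdduu ⟨γ g, C.apply_mem_PiYdd τ hC hS γ hγ g⟩) : D.GtpTheta), hf.1 _⟩)
    (g : (C.thetaEnvTower τ hC hS).PiYdd) (hk : D.toTheta ((g : C.Huu) : D.PiTemp) ∈ D.DeltaTheta) :
    ((F (C.inclYdduu g) : D.lDeltaTheta l) : D.GtpTheta) = D.toTheta ((g : C.Huu) : D.PiTemp) := by
  -- `g` lies in the tower's `θ⁻¹(l·Δ_Θ)`, hence so does `γ g`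
  have hgL : (g : (C.thetaEnvTower τ hC hS).PiX) ∈ (C.thetaEnvTower τ hC hS).lDeltaTheta :=
    C.mem_lDeltaTheta_tower_of_toTheta_mem τ hC hS g hk
  have hγgL : γ (g : (C.thetaEnvTower τ hC hS).PiX) ∈ (C.thetaEnvTower τ hC hS).lDeltaTheta := by
    have : γ (g : (C.thetaEnvTower τ hC hS).PiX) ∈
        (C.thetaEnvTower τ hC hS).lDeltaTheta.map γ.toMulEquiv.toMonoidHom := ⟨_, hgL, rfl⟩
    rwa [hL] at this
  -- `θ(γ g) ∈ Δ_Θ`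
  have hγk : D.toTheta (((C.inclYdduu ⟨γ g, C.apply_mem_PiYdd τ hC hS γ hγ g⟩ : C.GtpYdduu) : D.PiTemp)) ∈
      D.DeltaTheta := by
    have h1 : (γ (g : (C.thetaEnvTower τ hC hS).PiX) : C.Huu) ∈
        D.DeltaTheta.comap (D.toTheta.comp C.Huu.subtype) := by
      rw [C.comap_DeltaTheta_Huu]; exact hγgL
    exact h1
  -- the value of `f` at `γ g` is `θ(γ g)` = `γ̃ (θ g)`
  have hval : (⟨(f.1 (C.inclYdduu ⟨γ g, C.apply_mem_PiYdd τ hC hS γ hγ g⟩) : D.GtpTheta), hf.1 _⟩ : D.lDeltaTheta l) =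
      γΛ (C.toLDelta ⟨(g : (C.thetaEnvTower τ hC hS).PiX), hgL⟩) := by
    rw [← hγΛ ⟨(g : (C.thetaEnvTower τ hC hS).PiX), hgL⟩ hγgL]
    apply Subtype.ext
    rw [C.rootCocycle_apply hC h15 hf _ hγk, coe_toLDelta]
    rfl
  rw [hF g, hval, MulEquiv.symm_apply_apply, coe_toLDelta]

/-- **R1 + R2 together**: on `Π^tp_Ÿ̲̲ ∩ θ⁻¹(Δ_Θ)` the transport and every conjugate `conjRoot σ f` COINCIDE (exactly).
[cite: MochizukiEtTh2009, Cor 2.19(iii) p.65] -/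
theorem transport_coe_eq_conjRoot_coe_of_mem (hC : D.Compat) (hS : D.Sec2Hyps) (h15 : Prop15iii E hC)
    (γ : (C.thetaEnvTower τ hC hS).PiX ≃ₜ* (C.thetaEnvTower τ hC hS).PiX)
    (hγ : (C.thetaEnvTower τ hC hS).PiYdd.map γ.toMulEquiv.toMonoidHom = (C.thetaEnvTower τ hC hS).PiYdd)
    (hL : (C.thetaEnvTower τ hC hS).lDeltaTheta.map γ.toMulEquiv.toMonoidHom = (C.thetaEnvTower τ hC hS).lDeltaTheta)
    (γΛ : D.lDeltaTheta l ≃* D.lDeltaTheta l)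
    (hγΛ : ∀ (g : (C.thetaEnvTower τ hC hS).lDeltaTheta) (hg : γ g ∈ (C.thetaEnvTower τ hC hS).lDeltaTheta),
      C.toLDelta ⟨γ g, hg⟩ = γΛ (C.toLDelta g))
    {f : contCocycles D.toTheta D.DeltaTheta C.GtpYdduu} (hf : f ∈ C.rootCocycles hC)
    (F : C.GtpYdduu → D.lDeltaTheta l)
    (hF : ∀ g : (C.thetaEnvTower τ hC hS).PiYdd,
      F (C.inclYdduu g) = γΛ.symm ⟨(f.1 (C.inclYdduu ⟨γ g, C.apply_mem_PiYdd τ hC hS γ hγ g⟩) : D.GtpTheta), hf.1 _⟩)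
    (σ : C.Huu) (g : (C.thetaEnvTower τ hC hS).PiYdd) (hk : D.toTheta ((g : C.Huu) : D.PiTemp) ∈ D.DeltaTheta) :
    ((F (C.inclYdduu g) : D.lDeltaTheta l) : D.GtpTheta) = (C.conjRoot hC σ f.1 (C.inclYdduu g) : D.GtpTheta) := by
  rw [C.transport_coe_eq_toTheta_of_mem τ hC hS h15 γ hγ hL γΛ hγΛ hf F hF g hk,
    C.conjRoot_coe_eq_toTheta_of_mem hC h15 hf σ (C.inclYdduu g) hk]
  rfl

/-! ## §2. Multiplicativity on `Δ_P = Π^tp_Ÿ̲̲ ∩ Ker(aug)` (R3) -/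

/-- **(R3a)** A `Δ_Θ`-valued cocycle on `Π^tp_Ÿ̲̲` is MULTIPLICATIVE on `Δ_P = Π^tp_Ÿ̲̲ ∩ Ker(aug)`.
[cite: MochizukiEtTh2009, Cor 2.19(iii) p.65] -/
theorem apply_mul_of_aug_eq_one (f : contCocycles D.toTheta D.DeltaTheta C.GtpYdduu) (g h : C.GtpYdduu)
    (hg : D.aug.toMonoidHom (g : D.PiTemp) = 1) : f.1 (g * h) = f.1 g * f.1 h := by
  rw [f.2.2 g h, ThetaSetting.conjNormal_eq_of_aug_eq_one hg]

/-- **(R3b)** Every conjugate `conjRoot σ f` (`σ ∈ Π^tp_X̲̲`) of a cocycle is multiplicative on `Δ_P` (`σ⁻¹ g σ ∈ Ker aug`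
again, `Ker aug` being normal). [cite: MochizukiEtTh2009, Cor 2.19(iii) p.65] -/
theorem conjRoot_mul_of_aug_eq_one (hC : D.Compat) (f : contCocycles D.toTheta D.DeltaTheta C.GtpYdduu) (σ : C.Huu)
    (g h : C.GtpYdduu) (hg : D.aug.toMonoidHom (g : D.PiTemp) = 1) :
    C.conjRoot hC σ f.1 (g * h) = C.conjRoot hC σ f.1 g * C.conjRoot hC σ f.1 h := by
  have hprod : (⟨_, C.conj_mem_GtpYdduu hC σ (g * h)⟩ : C.GtpYdduu) =
      ⟨_, C.conj_mem_GtpYdduu hC σ g⟩ * ⟨_, C.conj_mem_GtpYdduu hC σ h⟩ := by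
    apply Subtype.ext
    change (σ : D.PiTemp)⁻¹ * ((g : D.PiTemp) * h) * σ = (σ : D.PiTemp)⁻¹ * g * σ * ((σ : D.PiTemp)⁻¹ * h * σ)
    group
  have hg' : D.aug.toMonoidHom (((⟨_, C.conj_mem_GtpYdduu hC σ g⟩ : C.GtpYdduu) : D.PiTemp)) = 1 := by
    change D.aug.toMonoidHom ((σ : D.PiTemp)⁻¹ * g * σ) = 1
    rw [map_mul, map_mul, map_inv, hg, mul_one, inv_mul_cancel]
  change MulAut.conjNormal (D.toTheta (σ : D.PiTemp)) (f.1 ⟨_, C.conj_mem_GtpYdduu hC σ (g * h)⟩) =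
    MulAut.conjNormal (D.toTheta (σ : D.PiTemp)) (f.1 ⟨_, C.conj_mem_GtpYdduu hC σ g⟩) *
      MulAut.conjNormal (D.toTheta (σ : D.PiTemp)) (f.1 ⟨_, C.conj_mem_GtpYdduu hC σ h⟩)
  rw [hprod, C.apply_mul_of_aug_eq_one f _ _ hg', map_mul]

/-- **(R3c)** The transport `F = Φ_γ f` is multiplicative on `Δ_P` (clause (b) of `exists_transport`: `F` satisfies the cocycle
law for the ORIGINAL action). [cite: MochizukiEtTh2009, Cor 2.19(iii) p.65] -/
theorem transport_mul_of_aug_eq_one (F : C.GtpYdduu → D.lDeltaTheta l)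
    (hFmul : ∀ g h : C.GtpYdduu, (F (g * h) : D.GtpTheta) =
      (F g : D.GtpTheta) * (D.toTheta (g : D.PiTemp) * (F h : D.GtpTheta) * (D.toTheta (g : D.PiTemp))⁻¹))
    (g h : C.GtpYdduu) (hg : D.aug.toMonoidHom (g : D.PiTemp) = 1) : F (g * h) = F g * F h := by
  apply Subtype.ext
  rw [hFmul, Subgroup.coe_mul]
  have hmem : D.toTheta (g : D.PiTemp) ∈ (D.aug.toMonoidHom.ker).map D.toTheta :=
    ⟨(g : D.PiTemp), (MonoidHom.mem_ker).2 hg, rfl⟩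
  rw [← D.ker_thetaToEll_central (F h : D.GtpTheta) (D.lDeltaTheta_le l (F h).2) _ hmem, mul_inv_cancel_right]

end ThetaSetting.EtaleThetaData.DoubleUnderline

/-! ## §3. The uniqueness principle (A): continuous homomorphisms agreeing on dense generators -/

/-- **(A)** Two continuous homomorphisms into a Hausdorff topological group that agree on a set `S` whose generated subgroup
is DENSE agree everywhere (equalizer closed + `MonoidHom.eqOn_closure`) — the uniqueness principle by which the proof of
Cor. 2.19 (iii) pins a cocycle on `Δ_{Y̲̲}` by its value at one topological generator (standard topological-group fact,
recorded here in the form the M1 route consumes). [cite: MochizukiEtTh2009, Cor 2.19(iii) p.65] -/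
theorem _root_.MonoidHom.eq_of_eqOn_of_dense_closure {G H : Type*} [Group G] [TopologicalSpace G]
    [Group H] [TopologicalSpace H] [T2Space H] {φ ψ : G →* H} (hφ : Continuous φ) (hψ : Continuous ψ)
    {S : Set G} (hS : Dense ((Subgroup.closure S : Subgroup G) : Set G)) (h : Set.EqOn φ ψ S) : φ = ψ := by
  have h1 : Set.EqOn φ ψ ((Subgroup.closure S : Subgroup G) : Set G) := MonoidHom.eqOn_closure h
  have h2 : Set.EqOn φ ψ (closure ((Subgroup.closure S : Subgroup G) : Set G)) := h1.closure hφ hψ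
  rw [hS.closure_eq] at h2
  exact MonoidHom.ext fun x => h2 (Set.mem_univ x)

/-! ## §4 (v2, append-only). (V1) The value of a conjugate at a GEOMETRIC element: `conjRoot σ f k = θ[σ⁻¹, k] · f k` -/

namespace ThetaSetting.EtaleThetaData.DoubleUnderline

variable {p : ℕ} [Fact p.Prime] {D : ThetaSetting p} {E : D.EtaleThetaData} {l : ℕ} (C : E.DoubleUnderline l)

/-- For `σ ∈ Π^tp_X̲̲` and `k ∈ Π^tp_Ÿ̲̲`, the commutator `σ⁻¹ k σ k⁻¹` lies in `Π^tp_Ÿ̲̲` (`Π^tp_Ÿ` is normal in `Π^tp_X`).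
[cite: MochizukiEtTh2009, Def 2.13 p.46] -/
theorem conj_mul_inv_mem_GtpYdduu (hC : D.Compat) (σ : C.Huu) (k : C.GtpYdduu) :
    (σ : D.PiTemp)⁻¹ * k * σ * (k : D.PiTemp)⁻¹ ∈ C.GtpYdduu :=
  C.GtpYdduu.mul_mem (C.conj_mem_GtpYdduu hC σ k) (C.GtpYdduu.inv_mem k.2)

/-- The commutator of two GEOMETRIC elements (`σ ∈ Π^tp_X̲̲ ∩ Ker aug`, `k ∈ Π^tp_Ÿ̲̲ ∩ Ker aug`) has `θ`-image in `Δ_Θ`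
(it dies in `(Π^tp_X)^ell`: abc-iut's `commutator_mem_comap_lDeltaTheta`, Prop. 2.12 (i)). [cite: MochizukiEtTh2009, Prop 2.12 (i) p.45] -/
theorem toTheta_conj_mul_inv_mem_DeltaTheta (σ : C.Huu) (hσ : D.aug.toMonoidHom (σ : D.PiTemp) = 1)
    (k : C.GtpYdduu) (hk : D.aug.toMonoidHom (k : D.PiTemp) = 1) :
    D.toTheta ((σ : D.PiTemp)⁻¹ * k * σ * (k : D.PiTemp)⁻¹) ∈ D.DeltaTheta := by
  have hkH : (k : D.PiTemp) ∈ C.Huu := (Subgroup.mem_inf.1 k.2).2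
  have hz : ((σ⁻¹ : C.Huu) : D.PiTemp) ∈ D.DeltaTemp := by
    change ((σ⁻¹ : C.Huu) : D.PiTemp) ∈ D.aug.toMonoidHom.ker
    rw [MonoidHom.mem_ker, Subgroup.coe_inv, map_inv, hσ, inv_one]
  have hb : ((⟨(k : D.PiTemp), hkH⟩ : C.Huu) : D.PiTemp) ∈ D.DeltaTemp := by
    change (k : D.PiTemp) ∈ D.aug.toMonoidHom.ker
    rw [MonoidHom.mem_ker, hk]
  have h := C.commutator_mem_comap_lDeltaTheta (σ⁻¹) ⟨(k : D.PiTemp), hkH⟩ 1 hz hb (by rw [Subgroup.coe_one, map_one])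
  rw [mul_one, Subgroup.mem_comap, MonoidHom.coe_comp, Function.comp_apply, Subgroup.coe_subtype] at h
  have h' : D.toTheta (((σ⁻¹ * ⟨(k : D.PiTemp), hkH⟩ * σ⁻¹⁻¹ * (⟨(k : D.PiTemp), hkH⟩ : C.Huu)⁻¹ : C.Huu) : D.PiTemp)) ∈
      D.DeltaTheta := D.lDeltaTheta_le l h
  rw [inv_inv] at h'
  exact h'

/-- **(V1) The value of a conjugate root cocycle at a geometric element.**  For a root cocycle `f`, `σ ∈ Π^tp_X̲̲ ∩ Ker aug` and
`k ∈ Δ_P = Π^tp_Ÿ̲̲ ∩ Ker aug`: `conjRoot σ f k = θ(σ⁻¹ k σ k⁻¹) · f k` in `(Π^tp_X)^Θ` — the outer conjugation by `θσ` is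
trivial (`conjNormal_eq_of_aug_eq_one`), `σ⁻¹kσ = [σ⁻¹,k]·k` with `[σ⁻¹,k] ∈ Δ_P ∩ θ⁻¹(Δ_Θ)`, `f` is multiplicative on `Δ_P`
(`apply_mul_of_aug_eq_one`) and tautological on `θ⁻¹(Δ_Θ)` (`rootCocycle_apply`).  With §1–§3: M1 at a model needs ONLY
(D1) `Δ_P` topologically generated by `Δ_P ∩ θ⁻¹(Δ_Θ)` and one `b`, and (D1') `m ↦ red_M θ[ã^{-m}, b]` onto `μ_M`.
[cite: MochizukiEtTh2009, Cor 2.19(iii) p.65] -/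
theorem conjRoot_coe_eq_toTheta_comm_mul (hC : D.Compat) (h15 : Prop15iii E hC)
    {f : contCocycles D.toTheta D.DeltaTheta C.GtpYdduu} (hf : f ∈ C.rootCocycles hC)
    (σ : C.Huu) (hσ : D.aug.toMonoidHom (σ : D.PiTemp) = 1)
    (k : C.GtpYdduu) (hk : D.aug.toMonoidHom (k : D.PiTemp) = 1) :
    (C.conjRoot hC σ f.1 k : D.GtpTheta) =
      D.toTheta ((σ : D.PiTemp)⁻¹ * k * σ * (k : D.PiTemp)⁻¹) * (f.1 k : D.GtpTheta) := by
  -- the commutator as a geometric element of `Π^tp_Ÿ̲̲` with `θ`-image in `Δ_Θ`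
  have hcaug : D.aug.toMonoidHom (((⟨_, C.conj_mul_inv_mem_GtpYdduu hC σ k⟩ : C.GtpYdduu) : D.PiTemp)) = 1 := by
    change D.aug.toMonoidHom ((σ : D.PiTemp)⁻¹ * k * σ * (k : D.PiTemp)⁻¹) = 1
    rw [map_mul, map_mul, map_mul, map_inv, map_inv, hσ, hk, inv_one, one_mul, mul_one, mul_one]
  have hcΘ : D.toTheta (((⟨_, C.conj_mul_inv_mem_GtpYdduu hC σ k⟩ : C.GtpYdduu) : D.PiTemp)) ∈ D.DeltaTheta :=
    C.toTheta_conj_mul_inv_mem_DeltaTheta σ hσ k hk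
  -- `σ⁻¹ k σ = [σ⁻¹, k] · k` in `Π^tp_Ÿ̲̲`
  have hsplit : (⟨_, C.conj_mem_GtpYdduu hC σ k⟩ : C.GtpYdduu) =
      (⟨_, C.conj_mul_inv_mem_GtpYdduu hC σ k⟩ : C.GtpYdduu) * k := by
    apply Subtype.ext
    change (σ : D.PiTemp)⁻¹ * k * σ = (σ : D.PiTemp)⁻¹ * k * σ * (k : D.PiTemp)⁻¹ * k
    rw [inv_mul_cancel_right]
  -- assemble
  change ((MulAut.conjNormal (D.toTheta (σ : D.PiTemp)) (f.1 ⟨_, C.conj_mem_GtpYdduu hC σ k⟩) : D.DeltaTheta) :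
    D.GtpTheta) = _
  rw [ThetaSetting.conjNormal_eq_of_aug_eq_one hσ, hsplit, C.apply_mul_of_aug_eq_one f _ _ hcaug, Subgroup.coe_mul,
    C.rootCocycle_apply hC h15 hf _ hcΘ]

/-- **(V1), transport side, for comparison**: at a geometric `k ∈ Δ_P` the M1 identity `red_M (F k) = red_M (conjRoot (ã^m) f k)`
reads `red_M (F k) = red_M (θ[ã^{-m}, k]) · red_M (f k)` — so, by §1–§3, once `Δ_P` is topologically generated by
`Δ_P ∩ θ⁻¹(Δ_Θ)` and one element `b`, M1 is the solvability in `m` of ONE equation in `μ_M` (recorded as the shape of the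
remaining model input; this lemma is the pointwise rewriting). [cite: MochizukiEtTh2009, Cor 2.19(iii) p.65] -/
theorem conjRoot_pow_coe_eq (hC : D.Compat) (h15 : Prop15iii E hC)
    {f : contCocycles D.toTheta D.DeltaTheta C.GtpYdduu} (hf : f ∈ C.rootCocycles hC)
    (a : C.Huu) (ha : D.aug.toMonoidHom (a : D.PiTemp) = 1) (m : ℤ)
    (k : C.GtpYdduu) (hk : D.aug.toMonoidHom (k : D.PiTemp) = 1) :
    (C.conjRoot hC (a ^ m) f.1 k : D.GtpTheta) =
      D.toTheta (((a ^ m : C.Huu) : D.PiTemp)⁻¹ * k * (a ^ m : C.Huu) * (k : D.PiTemp)⁻¹) * (f.1 k : D.GtpTheta) :=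
  C.conjRoot_coe_eq_toTheta_comm_mul hC h15 hf (a ^ m)
    (by rw [Subgroup.coe_zpow, map_zpow, ha, one_zpow]) k hk

end ThetaSetting.EtaleThetaData.DoubleUnderline

/-! ## §5 (v3, append-only). Bilinearity of geometric commutators modulo the centre: `θ[σ^{-n}, k] = θ[σ⁻¹, k]^n` -/

namespace ThetaSetting

variable {p : ℕ} [Fact p.Prime] (D : ThetaSetting p)

/-- The `θ`-image of a commutator of two GEOMETRIC elements of `Π^tp_X` lies in `Δ_Θ` (it dies in `(Π^tp_X)^ell = ` the
abelianised geometric quotient: `ker_toEll`). [cite: MochizukiEtTh2009, Prop 1.1 p.12] -/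
theorem toTheta_comm_mem_DeltaTheta {z b : D.PiTemp} (hz : D.aug.toMonoidHom z = 1) (hb : D.aug.toMonoidHom b = 1) :
    D.toTheta (z * b * z⁻¹ * b⁻¹) ∈ D.DeltaTheta := by
  have hmem : z * b * z⁻¹ * b⁻¹ ∈ (D.thetaToEll.comp D.toTheta).ker := by
    rw [D.ker_toEll, Subgroup.mem_comap]
    apply Subgroup.le_topologicalClosure
    simp only [map_mul, map_inv]
    have hz' : D.toHat.toMonoidHom z ∈ D.DeltaHat :=
      Subgroup.le_topologicalClosure _ ⟨z, (MonoidHom.mem_ker).2 hz, rfl⟩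
    have hb' : D.toHat.toMonoidHom b ∈ D.DeltaHat :=
      Subgroup.le_topologicalClosure _ ⟨b, (MonoidHom.mem_ker).2 hb, rfl⟩
    rw [← commutatorElement_def]
    exact Subgroup.commutator_mem_commutator hz' hb'
  rw [MonoidHom.mem_ker, MonoidHom.coe_comp, Function.comp_apply] at hmem
  exact hmem

/-- **Bilinearity in the first variable (natural powers).** For geometric `σ, k ∈ Π^tp_X` (`aug = 1`):
`θ((σ^n)⁻¹ k σ^n k⁻¹) = θ(σ⁻¹ k σ k⁻¹)^n` — `Δ_Θ` is central under `θ(Ker aug)` (`ker_thetaToEll_central`), so conjugating the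
commutator by `θσ` does not change it and the commutators add up. [cite: MochizukiEtTh2009, Prop 1.1 p.12] -/
theorem toTheta_conj_pow_comm (σ k : D.PiTemp) (hσ : D.aug.toMonoidHom σ = 1) (hk : D.aug.toMonoidHom k = 1) (n : ℕ) :
    D.toTheta ((σ ^ n)⁻¹ * k * σ ^ n * k⁻¹) = D.toTheta (σ⁻¹ * k * σ * k⁻¹) ^ n := by
  induction n with
  | zero => simp
  | succ n ih =>
    -- `(σ^{n+1})⁻¹ k σ^{n+1} k⁻¹ = σ⁻¹ · ((σ^n)⁻¹ k σ^n k⁻¹) · σ · (σ⁻¹ k σ k⁻¹)`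
    have hgrp : (σ ^ (n + 1))⁻¹ * k * σ ^ (n + 1) * k⁻¹ =
        σ⁻¹ * ((σ ^ n)⁻¹ * k * σ ^ n * k⁻¹) * σ * (σ⁻¹ * k * σ * k⁻¹) := by
      rw [pow_succ]; group
    have hσinv : D.aug.toMonoidHom σ⁻¹ = 1 := by rw [map_inv, hσ, inv_one]
    have hcen : D.toTheta ((σ ^ n)⁻¹ * k * σ ^ n * k⁻¹) * D.toTheta σ = D.toTheta σ * D.toTheta ((σ ^ n)⁻¹ * k * σ ^ n * k⁻¹) := by
      have hmemΔ : D.toTheta ((σ ^ n)⁻¹ * k * σ ^ n * k⁻¹) ∈ D.DeltaTheta := by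
        rw [ih]; exact pow_mem (D.toTheta_comm_mem_DeltaTheta hσinv hk |> fun h => by simpa [inv_inv] using h) n
      exact D.ker_thetaToEll_central _ hmemΔ (D.toTheta σ) ⟨σ, (MonoidHom.mem_ker).2 hσ, rfl⟩
    rw [hgrp, map_mul, map_mul, map_mul, map_inv, mul_assoc (D.toTheta σ)⁻¹, hcen, ← mul_assoc, inv_mul_cancel, one_mul, ih,
      pow_succ]

/-- `θ[σ, k] = θ[σ⁻¹, k]⁻¹` for geometric `σ, k` (conjugate the commutator by `θσ`, which acts trivially on `Δ_Θ`).
[cite: MochizukiEtTh2009, Prop 1.1 p.12] -/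
theorem toTheta_comm_inv_eq (σ k : D.PiTemp) (hσ : D.aug.toMonoidHom σ = 1) (hk : D.aug.toMonoidHom k = 1) :
    D.toTheta (σ * k * σ⁻¹ * k⁻¹) = (D.toTheta (σ⁻¹ * k * σ * k⁻¹))⁻¹ := by
  have hσinv : D.aug.toMonoidHom σ⁻¹ = 1 := by rw [map_inv, hσ, inv_one]
  have hmemΔ : D.toTheta (σ⁻¹ * k * σ * k⁻¹) ∈ D.DeltaTheta := by
    simpa [inv_inv] using D.toTheta_comm_mem_DeltaTheta hσinv hk
  have hcen := D.ker_thetaToEll_central _ hmemΔ (D.toTheta σ) ⟨σ, (MonoidHom.mem_ker).2 hσ, rfl⟩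
  -- `σ (σ⁻¹kσk⁻¹) σ⁻¹ = k σ k⁻¹ σ⁻¹ = (σ k σ⁻¹ k⁻¹)⁻¹`
  have hgrp : σ * k * σ⁻¹ * k⁻¹ = (σ * (σ⁻¹ * k * σ * k⁻¹) * σ⁻¹)⁻¹ := by group
  rw [hgrp, map_inv, map_mul, map_mul, map_inv, ← hcen, mul_inv_cancel_right]

/-- **Bilinearity for integer powers**: `θ((σ^m)⁻¹ k σ^m k⁻¹) = θ(σ⁻¹ k σ k⁻¹)^m`, `m : ℤ` — so `m ↦ red_M θ[σ^{-m}, k]` is the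
homomorphism `m ↦ (red_M θ[σ⁻¹, k])^m` and (D1') of the COR219III-M1 handoff reads «`red_M θ[ã⁻¹, b]` generates `μ_M`».
[cite: MochizukiEtTh2009, Prop 1.1 p.12] -/
theorem toTheta_conj_zpow_comm (σ k : D.PiTemp) (hσ : D.aug.toMonoidHom σ = 1) (hk : D.aug.toMonoidHom k = 1) (m : ℤ) :
    D.toTheta ((σ ^ m)⁻¹ * k * σ ^ m * k⁻¹) = D.toTheta (σ⁻¹ * k * σ * k⁻¹) ^ m := by
  obtain ⟨n, rfl | rfl⟩ := m.eq_nat_or_neg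
  · rw [zpow_natCast, zpow_natCast]
    exact D.toTheta_conj_pow_comm σ k hσ hk n
  · have hσinv : D.aug.toMonoidHom σ⁻¹ = 1 := by rw [map_inv, hσ, inv_one]
    rw [zpow_neg, zpow_natCast, ← inv_pow, zpow_neg, zpow_natCast]
    -- `((σ⁻¹)^n)⁻¹ k (σ⁻¹)^n k⁻¹` with base `σ⁻¹`
    have h := D.toTheta_conj_pow_comm σ⁻¹ k hσinv hk n
    rw [h, inv_inv, D.toTheta_comm_inv_eq σ k hσ hk, inv_pow]

end ThetaSetting

/-! ## §6 (v4, append-only). M1 ASSEMBLED generically from (D1*) uniqueness on `Δ_P` and (D1′) onto -/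

namespace ThetaSetting.EtaleThetaData.DoubleUnderline

variable {p : ℕ} [Fact p.Prime] {D : ThetaSetting p} {E : D.EtaleThetaData} {l : ℕ}
  (C : E.DoubleUnderline l) {Es : Set ℕ+} (τ : D.CyclotomeTower l Es)

/-- **M1 ASSEMBLED, generic form: the heart from (D1*) «uniqueness on `Δ_P`» and (D1′) «the commutator character is onto».**
Over ANY §1 setting: let `γ` stabilise `Π^tp_Ÿ̲̲` and `θ⁻¹(l·Δ_Θ)`, `γ̃` be induced, `f` a root cocycle with transport `F = Φ_γ f`
(clauses (a), (b) of `exists_transport`), `ã ∈ Π^tp_X̲̲ ∩ Ker aug`, `b ∈ Δ_P := Π^tp_Ÿ̲̲ ∩ Ker aug`, and a level `M`.  ASSUME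
(D1*) two locally constant `μ_M`-valued functions on `Π^tp_Ÿ̲̲` that are multiplicative on `Δ_P`, agree on `Δ_P ∩ θ⁻¹(Δ_Θ)` and at `b`
agree on all of `Δ_P` (at a model: `Δ_P` is topologically generated by `Δ_P ∩ θ⁻¹(Δ_Θ)` and `b`, plus
`MonoidHom.eq_of_eqOn_of_dense_closure`); (D1′) `m ↦ red_M θ[ã^{-m}, b]` is ONTO `μ_M`; and local constancy of the two sides
(⟸ `ThetaEnvTower.locallyConstant` + clause (c) of `exists_transport`).  THEN there is `m : ℤ` with
`red_M (F k) = red_M (conjRoot (ã^m) f k)` for every `k ∈ Δ_P` — the conclusion of M1.  Proof: §1 (agreement on `θ⁻¹(Δ_Θ)`), §2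
(multiplicativity), §4 (value at `b` = `θ[ã^{-m},b] · f b`), and the choice of `m` by (D1′). [cite: MochizukiEtTh2009, Cor 2.19(iii) p.65] -/
theorem heart_of_uniqueness_of_onto (hC : D.Compat) (hS : D.Sec2Hyps) (h15 : Prop15iii E hC)
    (γ : (C.thetaEnvTower τ hC hS).PiX ≃ₜ* (C.thetaEnvTower τ hC hS).PiX)
    (hγ : (C.thetaEnvTower τ hC hS).PiYdd.map γ.toMulEquiv.toMonoidHom = (C.thetaEnvTower τ hC hS).PiYdd)
    (hL : (C.thetaEnvTower τ hC hS).lDeltaTheta.map γ.toMulEquiv.toMonoidHom = (C.thetaEnvTower τ hC hS).lDeltaTheta)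
    (γΛ : D.lDeltaTheta l ≃* D.lDeltaTheta l)
    (hγΛ : ∀ (g : (C.thetaEnvTower τ hC hS).lDeltaTheta) (hg : γ g ∈ (C.thetaEnvTower τ hC hS).lDeltaTheta),
      C.toLDelta ⟨γ g, hg⟩ = γΛ (C.toLDelta g))
    {f : contCocycles D.toTheta D.DeltaTheta C.GtpYdduu} (hf : f ∈ C.rootCocycles hC)
    (F : C.GtpYdduu → D.lDeltaTheta l)
    (hF : ∀ g : (C.thetaEnvTower τ hC hS).PiYdd,
      F (C.inclYdduu g) = γΛ.symm ⟨(f.1 (C.inclYdduu ⟨γ g, C.apply_mem_PiYdd τ hC hS γ hγ g⟩) : D.GtpTheta), hf.1 _⟩)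
    (hFmul : ∀ g h : C.GtpYdduu, (F (g * h) : D.GtpTheta) =
      (F g : D.GtpTheta) * (D.toTheta (g : D.PiTemp) * (F h : D.GtpTheta) * (D.toTheta (g : D.PiTemp))⁻¹))
    (a : C.Huu) (ha : D.aug.toMonoidHom (a : D.PiTemp) = 1)
    (b : (C.thetaEnvTower τ hC hS).PiYdd) (hb : D.aug.toMonoidHom ((b : C.Huu) : D.PiTemp) = 1) (M : Es)
    -- (D1*) uniqueness on `Δ_P`
    (huniq : ∀ φ ψ : (C.thetaEnvTower τ hC hS).PiYdd → MuN p M, IsLocallyConstant φ → IsLocallyConstant ψ →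
      (∀ g h : (C.thetaEnvTower τ hC hS).PiYdd, D.aug.toMonoidHom ((g : C.Huu) : D.PiTemp) = 1 →
        D.aug.toMonoidHom ((h : C.Huu) : D.PiTemp) = 1 → φ (g * h) = φ g * φ h) →
      (∀ g h : (C.thetaEnvTower τ hC hS).PiYdd, D.aug.toMonoidHom ((g : C.Huu) : D.PiTemp) = 1 →
        D.aug.toMonoidHom ((h : C.Huu) : D.PiTemp) = 1 → ψ (g * h) = ψ g * ψ h) →
      (∀ g : (C.thetaEnvTower τ hC hS).PiYdd, D.aug.toMonoidHom ((g : C.Huu) : D.PiTemp) = 1 →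
        D.toTheta ((g : C.Huu) : D.PiTemp) ∈ D.DeltaTheta → φ g = ψ g) →
      φ b = ψ b →
      ∀ g : (C.thetaEnvTower τ hC hS).PiYdd, D.aug.toMonoidHom ((g : C.Huu) : D.PiTemp) = 1 → φ g = ψ g)
    -- (D1′) the commutator character at `b` is onto `μ_M`
    (honto : ∀ u : MuN p M, ∃ (m : ℤ) (hm : D.toTheta ((((a ^ m : C.Huu) : D.PiTemp))⁻¹ * ((b : C.Huu) : D.PiTemp) *
        ((a ^ m : C.Huu) : D.PiTemp) * (((b : C.Huu) : D.PiTemp))⁻¹) ∈ D.lDeltaTheta l), (τ.mod M).red ⟨_, hm⟩ = u)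
    -- local constancy of the two sides
    (hFlc : IsLocallyConstant fun g : (C.thetaEnvTower τ hC hS).PiYdd => (τ.mod M).red (F (C.inclYdduu g)))
    (hclc : ∀ m : ℤ, IsLocallyConstant fun g : (C.thetaEnvTower τ hC hS).PiYdd =>
      (τ.mod M).red ⟨(C.conjRoot hC (a ^ m) f.1 (C.inclYdduu g) : D.GtpTheta),
        (D.lDeltaTheta_normal l).conj_mem _ (hf.1 _) _⟩) :
    ∃ m : ℤ, ∀ g : (C.thetaEnvTower τ hC hS).PiYdd, D.aug.toMonoidHom ((g : C.Huu) : D.PiTemp) = 1 →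
      (τ.mod M).red (F (C.inclYdduu g)) =
        (τ.mod M).red ⟨(C.conjRoot hC (a ^ m) f.1 (C.inclYdduu g) : D.GtpTheta),
          (D.lDeltaTheta_normal l).conj_mem _ (hf.1 _) _⟩ := by
  -- the target value of the commutator character and the corresponding `m`
  obtain ⟨m, hm, hred⟩ := honto ((τ.mod M).red (F (C.inclYdduu b)) *
    ((τ.mod M).red ⟨(f.1 (C.inclYdduu b) : D.GtpTheta), hf.1 _⟩)⁻¹)
  have ham : D.aug.toMonoidHom ((a ^ m : C.Huu) : D.PiTemp) = 1 := by
    rw [Subgroup.coe_zpow, map_zpow, ha, one_zpow]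
  refine ⟨m, huniq _ _ hFlc (hclc m) ?_ ?_ ?_ ?_⟩
  · -- `red_M ∘ F` is multiplicative on `Δ_P`
    intro g h hg _
    rw [map_mul, C.transport_mul_of_aug_eq_one F hFmul _ _ hg, map_mul]
  · -- `red_M ∘ conjRoot (ã^m) f` is multiplicative on `Δ_P`
    intro g h hg _
    rw [← map_mul]
    congr 1
    apply Subtype.ext
    change (C.conjRoot hC (a ^ m) f.1 (C.inclYdduu (g * h)) : D.GtpTheta) =
      (C.conjRoot hC (a ^ m) f.1 (C.inclYdduu g) : D.GtpTheta) * (C.conjRoot hC (a ^ m) f.1 (C.inclYdduu h) : D.GtpTheta)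
    rw [map_mul, C.conjRoot_mul_of_aug_eq_one hC f (a ^ m) _ _ hg, Subgroup.coe_mul]
  · -- agreement on `Δ_P ∩ θ⁻¹(Δ_Θ)` (§1)
    intro g _ hk
    congr 1
    apply Subtype.ext
    exact C.transport_coe_eq_conjRoot_coe_of_mem τ hC hS h15 γ hγ hL γΛ hγΛ hf F hF (a ^ m) g hk
  · -- agreement at `b` (§4 and the choice of `m`)
    have hsplit : (⟨(C.conjRoot hC (a ^ m) f.1 (C.inclYdduu b) : D.GtpTheta),
        (D.lDeltaTheta_normal l).conj_mem _ (hf.1 _) _⟩ : D.lDeltaTheta l) =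
        ⟨_, hm⟩ * ⟨(f.1 (C.inclYdduu b) : D.GtpTheta), hf.1 _⟩ := by
      apply Subtype.ext
      rw [Subgroup.coe_mul]
      exact C.conjRoot_pow_coe_eq hC h15 hf a ha m (C.inclYdduu b) hb
    rw [hsplit, map_mul, hred, inv_mul_cancel_right]

end ThetaSetting.EtaleThetaData.DoubleUnderline

end Literature.AnabelianGeometry.EtaleTheta

end
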